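import Mathlib
import Summits.ValiantsHypothesis.ValiantsHypothesis.Theorems.LacunarySymmetroidMatrixDescartesDefiniteMomentsZonesCorollaries

/-!
# `MatrixDescartes` (stmt-ValiantsHypothesis-18050) — the DEFINITE-MOMENTS LAW, zones IX: the intrinsic hyperbolic sector
# is OPEN (a full-dimensional family at every lacunary format)

HONEST FRAMING.  Cell `pub-symmetroid`, seat `val-sym-mdr-p2` (gen 15); helper file `--supports` the crux
`Theses.LacunarySymmetroid.MatrixDescartes`, NO closure claim.  A robustness statement about the SCOPE of the lacunary Markus
theorem; nothing here bears on the crux in its window, on `stub_twoSided`, on `DoorA26`/`DoorA34`, registers, or `VP ≠ VNP`.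

THEOREM (`rayleighSharp_open`).  If the pencil with `K ≥ 2` real symmetric letters `Sₗ` at strictly increasing exponents is
Rayleigh-sharp, then there is `ε > 0` such that every letter family `Sₗ + Eₗ` with `|Eₗ(i,k)| ≤ ε` entrywise is again
Rayleigh-sharp.  (Characterisation `rayleighSharp_iff_alternatingScales`: the `K` alternating definite scales of `S` have a
uniform margin on the compact unit sphere, which absorbs a perturbation of size `card ι² · ε · ∑ₗ aⱼ^{dₗ}`.)  So the law
`Z₊ ≤ (K−1)·m` of `card_posRoots_le_of_rayleighSharp` holds on an OPEN set of letter families, non-void at every format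
(it contains the diagonal Descartes-sharp words with separated scales). [folklore]; axioms standard; no definitions.
-/

-- layout Summits/ValiantsHypothesis/ValiantsHypothesis forces the duplicated namespace component
set_option linter.dupNamespace false

namespace Summit.ValiantsHypothesis.ValiantsHypothesis.Theorems.LacunarySymmetroidMatrixDescartes

open Polynomial Matrix Finset
open scoped BigOperators

namespace DefiniteMoments

section Open

variable {ι : Type} [Fintype ι]

/-- Entrywise bound ⇒ quadratic-form bound on the unit sup-ball: `|vᵀAv| ≤ card ι² · ε`. [folklore] -/
theorem abs_quadForm_le (A : Matrix ι ι ℝ) (ε : ℝ) (hA : ∀ i j, |A i j| ≤ ε) (v : ι → ℝ) (hv : ‖v‖ ≤ 1) :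
    |v ⬝ᵥ (A *ᵥ v)| ≤ (Fintype.card ι : ℝ) ^ 2 * ε := by
  have hvi : ∀ i, |v i| ≤ 1 := fun i => by
    have h := norm_le_pi_norm v i
    rw [Real.norm_eq_abs] at h
    exact h.trans hv
  have h1 : v ⬝ᵥ (A *ᵥ v) = ∑ i, ∑ j, v i * (A i j * v j) := by
    simp only [Matrix.mulVec, dotProduct, Finset.mul_sum]
  rw [h1]
  calc |∑ i, ∑ j, v i * (A i j * v j)|
      ≤ ∑ i, |∑ j, v i * (A i j * v j)| := Finset.abs_sum_le_sum_abs _ _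
    _ ≤ ∑ i, ∑ j, |v i * (A i j * v j)| := Finset.sum_le_sum fun i _ => Finset.abs_sum_le_sum_abs _ _
    _ ≤ ∑ _i : ι, ∑ _j : ι, ε := Finset.sum_le_sum fun i _ => Finset.sum_le_sum fun j _ => by
        have hε : 0 ≤ ε := (abs_nonneg _).trans (hA i i)
        rw [abs_mul, abs_mul]
        calc |v i| * (|A i j| * |v j|) ≤ 1 * (ε * 1) :=
              mul_le_mul (hvi i) (mul_le_mul (hA i j) (hvi j) (abs_nonneg _) hε) (by positivity) zero_le_one
          _ = ε := by ring
    _ = (Fintype.card ι : ℝ) ^ 2 * ε := by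
        simp only [Finset.sum_const, Finset.card_univ, nsmul_eq_mul]; ring

omit [Fintype ι] in
/-- Entries of an evaluated perturbation pencil: `|(∑ₗ x^{dₗ} Eₗ)(i,k)| ≤ ε · ∑ₗ x^{dₗ}` for `x ≥ 0`, `|Eₗ(i,k)| ≤ ε`.
[folklore] -/
theorem abs_eval_entry_le {K : ℕ} (d : Fin K → ℕ) (E : Fin K → Matrix ι ι ℝ) (ε : ℝ) (hE : ∀ l i j, |E l i j| ≤ ε)
    {x : ℝ} (hx : 0 ≤ x) (i j : ι) : |(∑ k, x ^ d k • E k) i j| ≤ ε * ∑ k, x ^ d k := by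
  rw [Matrix.sum_apply, Finset.mul_sum]
  refine (Finset.abs_sum_le_sum_abs _ _).trans (Finset.sum_le_sum fun k _ => ?_)
  rw [Matrix.smul_apply, smul_eq_mul, abs_mul, abs_of_nonneg (pow_nonneg hx _), mul_comm]
  exact mul_le_mul_of_nonneg_right (hE k i j) (pow_nonneg hx _)

/-- Quadratic forms scale by the square: `(c·w)ᵀM(c·w) = c²·wᵀMw`. [folklore] -/
theorem quadForm_smul (M : Matrix ι ι ℝ) (c : ℝ) (w : ι → ℝ) :
    (c • w) ⬝ᵥ (M *ᵥ (c • w)) = c ^ 2 * (w ⬝ᵥ (M *ᵥ w)) := by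
  rw [Matrix.mulVec_smul, dotProduct_smul, smul_dotProduct, smul_eq_mul, smul_eq_mul]; ring

/-- **THE INTRINSIC HYPERBOLIC SECTOR IS OPEN.**  `K ≥ 2` real symmetric letters at strictly increasing exponents forming a
Rayleigh-sharp pencil: some `ε > 0` makes every entrywise `ε`-perturbation `Sₗ + Eₗ` Rayleigh-sharp as well. [folklore] -/
theorem rayleighSharp_open {K : ℕ} (hK : 2 ≤ K) (d : Fin K → ℕ) (hd : StrictMono d) (S : Fin K → Matrix ι ι ℝ)
    (hS : ∀ l, (S l).IsSymm)
    (hsharp : ∀ v : ι → ℝ, v ≠ 0 →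
      K ≤ ((∑ l, C (v ⬝ᵥ (S l *ᵥ v)) * (X : ℝ[X]) ^ d l).roots.toFinset.filter (fun t => 0 < t)).card + 1) :
    ∃ ε : ℝ, 0 < ε ∧ ∀ E : Fin K → Matrix ι ι ℝ, (∀ l i j, |E l i j| ≤ ε) →
      ∀ v : ι → ℝ, v ≠ 0 →
        K ≤ ((∑ l, C (v ⬝ᵥ ((S l + E l) *ᵥ v)) * (X : ℝ[X]) ^ d l).roots.toFinset.filter (fun t => 0 < t)).card + 1 := by
  classical
  rcases isEmpty_or_nonempty ι with hι | hι
  · exact ⟨1, one_pos, fun E _ v hv => absurd (Subsingleton.elim v 0) hv⟩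
  obtain ⟨a, σ, ha, ha0, hσ1, hdef⟩ := exists_alternatingScales_of_rayleighSharp hK d hd S hS hsharp
  have hapos : ∀ j, 0 < a j := fun j => ha0.trans_le (ha.monotone (Fin.zero_le _))
  have hσabs : |σ| = 1 := by rcases hσ1 with h | h <;> simp [h]
  -- uniform margins on the unit sphere
  set Sph := Metric.sphere (0 : ι → ℝ) 1 with hSph
  have hcpt : IsCompact Sph := isCompact_sphere 0 1
  have hSph0 : ∀ v ∈ Sph, v ≠ 0 := by
    intro v hv h0
    rw [hSph, mem_sphere_zero_iff_norm, h0, norm_zero] at hv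
    exact zero_ne_one hv
  have hne : Sph.Nonempty := by
    have h1 : (fun _ : ι => (1 : ℝ)) ≠ 0 := by
      intro h; have := congrFun h (Classical.arbitrary ι); simp at this
    have hn : ‖(fun _ : ι => (1 : ℝ))‖ ≠ 0 := norm_ne_zero_iff.2 h1
    refine ⟨‖(fun _ : ι => (1 : ℝ))‖⁻¹ • (fun _ : ι => (1 : ℝ)), ?_⟩
    rw [hSph, mem_sphere_zero_iff_norm, norm_smul, norm_inv, norm_norm, inv_mul_cancel₀ hn]
  have hμ : ∀ j : Fin (K - 1 + 1), ∃ μ : ℝ, 0 < μ ∧ ∀ v ∈ Sph,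
      μ ≤ σ * (-1) ^ (j : ℕ) * (v ⬝ᵥ ((∑ k, a j ^ d k • S k) *ᵥ v)) := by
    intro j
    have hc : ContinuousOn (fun v : ι → ℝ => σ * (-1) ^ (j : ℕ) * (v ⬝ᵥ ((∑ k, a j ^ d k • S k) *ᵥ v))) Sph :=
      (continuous_const.mul (continuous_quadForm _)).continuousOn
    obtain ⟨v₀, hv₀, hmin⟩ := hcpt.exists_isMinOn hne hc
    refine ⟨_, hdef j v₀ (hSph0 v₀ hv₀), fun v hv => ?_⟩
    exact hmin hv
  choose μ hμ0 hμ using hμ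
  obtain ⟨j₀, -, hj₀⟩ := Finset.exists_min_image Finset.univ μ Finset.univ_nonempty
  -- growth constants of the perturbation at the scales
  set Cst : Fin (K - 1 + 1) → ℝ := fun j => (Fintype.card ι : ℝ) ^ 2 * ∑ k, a j ^ d k with hCst
  obtain ⟨j₁, -, hj₁⟩ := Finset.exists_max_image Finset.univ Cst Finset.univ_nonempty
  have hC0 : 0 ≤ Cst j₁ := by
    simp only [hCst]
    exact mul_nonneg (by positivity) (Finset.sum_nonneg fun k _ => pow_nonneg (hapos j₁).le _)
  set ε := μ j₀ / (2 * (Cst j₁ + 1)) with hε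
  have hεpos : 0 < ε := div_pos (hμ0 j₀) (by linarith)
  refine ⟨ε, hεpos, fun E hE => ?_⟩
  -- the perturbed pencil is definite with alternating signs at the same scales
  refine rayleighSharp_of_alternatingScales hK d (fun l => S l + E l) a ha ha0 σ fun j u hu => ?_
  have hsplit : (∑ k, a j ^ d k • (S k + E k)) = (∑ k, a j ^ d k • S k) + ∑ k, a j ^ d k • E k := by
    rw [← Finset.sum_add_distrib]
    exact Finset.sum_congr rfl fun k _ => smul_add _ _ _
  -- normalise `u`
  have hun : ‖u‖ ≠ 0 := norm_ne_zero_iff.2 hu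
  set w := ‖u‖⁻¹ • u with hw
  have hwS : w ∈ Sph := by
    rw [hSph, mem_sphere_zero_iff_norm, hw, norm_smul, norm_inv, norm_norm, inv_mul_cancel₀ hun]
  have huw : u = ‖u‖ • w := by rw [hw, smul_smul, mul_inv_cancel₀ hun, one_smul]
  -- the unit-vector estimate
  have hmain : 0 < σ * (-1) ^ (j : ℕ) * (w ⬝ᵥ ((∑ k, a j ^ d k • (S k + E k)) *ᵥ w)) := by
    rw [hsplit, Matrix.add_mulVec, dotProduct_add, mul_add]
    have h1 := hμ j w hwS
    have h2 : |σ * (-1) ^ (j : ℕ) * (w ⬝ᵥ ((∑ k, a j ^ d k • E k) *ᵥ w))| ≤ Cst j * ε := by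
      rw [abs_mul, abs_mul, hσabs, abs_pow, abs_neg, abs_one, one_pow, one_mul, one_mul]
      have hw1 : ‖w‖ ≤ 1 := by rw [hSph, mem_sphere_zero_iff_norm] at hwS; exact hwS.le
      have h := abs_quadForm_le (∑ k, a j ^ d k • E k) (ε * ∑ k, a j ^ d k)
        (fun i i' => abs_eval_entry_le d E ε hE (hapos j).le i i') w hw1
      simp only [hCst]
      calc |w ⬝ᵥ ((∑ k, a j ^ d k • E k) *ᵥ w)| ≤ (Fintype.card ι : ℝ) ^ 2 * (ε * ∑ k, a j ^ d k) := h
        _ = (Fintype.card ι : ℝ) ^ 2 * (∑ k, a j ^ d k) * ε := by ring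
    have h3 : Cst j * ε ≤ Cst j₁ * ε := mul_le_mul_of_nonneg_right (hj₁ j (Finset.mem_univ _)) hεpos.le
    have h4 : Cst j₁ * ε < μ j₀ := by
      rw [hε]
      have hpos : 0 < Cst j₁ + 1 := by linarith
      calc Cst j₁ * (μ j₀ / (2 * (Cst j₁ + 1))) = μ j₀ * (Cst j₁ / (2 * (Cst j₁ + 1))) := by ring
        _ < μ j₀ * 1 := by
            refine mul_lt_mul_of_pos_left ?_ (hμ0 j₀)
            rw [div_lt_one (by linarith)]; linarith
        _ = μ j₀ := mul_one _
    have h5 := hj₀ j (Finset.mem_univ _)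
    have h6 := neg_abs_le (σ * (-1) ^ (j : ℕ) * (w ⬝ᵥ ((∑ k, a j ^ d k • E k) *ᵥ w)))
    linarith
  rw [huw, quadForm_smul, ← mul_assoc]
  have e : σ * (-1) ^ (j : ℕ) * ‖u‖ ^ 2 * (w ⬝ᵥ ((∑ k, a j ^ d k • (S k + E k)) *ᵥ w))
      = ‖u‖ ^ 2 * (σ * (-1) ^ (j : ℕ) * (w ⬝ᵥ ((∑ k, a j ^ d k • (S k + E k)) *ᵥ w))) := by ring
  rw [e]
  exact mul_pos (pow_pos (norm_pos_iff.2 hu) 2) hmain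

end Open

end DefiniteMoments

end Summit.ValiantsHypothesis.ValiantsHypothesis.Theorems.LacunarySymmetroidMatrixDescartes
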